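import Literature.Geometry.MetricEmbeddings.HeisenbergSmearVertical
import Literature.Geometry.MetricEmbeddings.HeisenbergL1NaorYoung
import HarnessLib

/-!
# Discretization: from the continuous `L₄` vertical-versus-horizontal inequality on `ℍ(ℝ)` to the
partial sums `Σ_{t≤T} |∂ᵗ_v Ω|⁴/t³ ≤ (C|∂_hΩ|)⁴` on `ℍ(ℤ)`, and the Cheeger–Kleiner–Naor bound

Family `pnp`, layer `Literature/Geometry/MetricEmbeddings` (theorems only). Source: A. Naor,
R. Young, *Vertical perimeter versus horizontal perimeter*, Ann. of Math. 188 (2018) =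
arXiv:1701.00620, §3.2 **Lemma 3.6** (arXiv p. 22): "Fix `k ∈ ℕ` and `𝒲 : [1,∞) → [0,∞)` […]
`w_t ≝ ∫_t^{t+1} 𝒲(s) ds`. Fix also `C ∈ (0,∞)` and `p, q ∈ (0,∞)` with `p ≥ 1`. Let `X` be a normed
space such that every smooth and compactly supported function `Φ : ℍ^{2k+1} → X` satisfies
`(∫_1^∞ 𝒲(t) (∫ ‖Φ(hZᵗ) − Φ(h)‖^p dh)^{q/p} dt)^{1/q} ≤ C (∫ ‖∇_ℍΦ‖^p dh)^{1/p}` (3.6). Then every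
finitely supported `φ : ℍ_ℤ^{2k+1} → X` satisfies
`(Σ_{t≥1} w_t (Σ_h ‖φ(hZᵗ) − φ(h)‖^p)^{q/p})^{1/q} ≲ (C + ‖𝒲‖^{1/q}) (Σ_h Σ_σ ‖φ(hσ)−φ(h)‖^p)^{1/p}`",
in the case `k = 1`, `𝒲(s) = s⁻³`, `p = 1`, `q = 4`, `X = ℝ`, `φ = 𝟙_Ω` — where by (the trivial
direction of) [NY18, Lemma 3.1] `Σ_h |𝟙_Ω(hZᵗ) − 𝟙_Ω(h)| = |∂ᵗ_v Ω|` and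
`Σ_h Σ_σ |𝟙_Ω(hσ) − 𝟙_Ω(h)| = 2|∂_h Ω|` — and A. Naor, R. Young, *Foliated corona decompositions*,
Acta Math. 229 (2022) §1.1.1 (arXiv:2004.12522 p. 5): "if every compactly supported smooth function
`f : ℝ³ → ℝ` satisfies the inequality (1.7) then by [NY18] and the reasoning in [NY18] we have
`c_{ℓ₁}(𝓑_n) ≳ (log n)^{1/p}`".

## What is proved

* `partialSums_of_leftSobolevL4` — the DISCRETIZATION: if every smooth compactly supported
  `f : ℍ(ℝ) → ℝ` (matrix model on `ℝ³`) satisfies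
  `∫_0^∞ (∫ |f(h cᵗ) − f(h)| dh)⁴ dt/t³ ≤ K⁴ (∫ (|Xf| + |Yf|) dh)⁴`
  (`X = D(·)[(1,0,0)]`, `Y_h = D(·)[(0,1,h₁)]` the LEFT-invariant horizontal derivatives — the natural
  ones for the lattice `ℍ(ℤ) ⊂ ℍ(ℝ)` acting on the left; the `dt`-integral a lower Lebesgue
  integral, so that no integrability is presupposed), then for all finite `Ω ⊂ ℍ_ℤ³` and all `T`,
  `Σ_{t=1}^{T} |∂ᵗ_v Ω|⁴/t³ ≤ (C|∂_h Ω|)⁴` (counted boundaries), `C = 4K·C₂ + 2C₃ + 1`. Proof as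
  printed: apply the hypothesis to the smearing `F = Σ_{g ∈ Ω} χ_g` (`HeisenbergLatticeBump.lean`),
  bound its right side by `C₂|∂_hΩ|` (`integral_fderiv_smear_le`) and, for `t ∈ [k, k+1]`,
  `|∂ᵏ_v Ω| ≤ ∫|F(hcᵗ) − F(h)|dh + C₃|∂_hΩ|` (`dispCount_center_le_integral`), raise to the fourth
  power (`(A+b)⁴ ≤ 8(A⁴+b⁴)`), integrate `dt/t³` over `[k, k+1]` and sum over `k ≤ T`
  (`Σ 1/k³ ≤ 2`).
* `CheegerKleinerNaor2011_wordBall_l1Distortion.of_leftSobolevL4` — with `of_partialSums`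
  (`HeisenbergL1NaorYoung.lean`): the same hypothesis implies the vendored [CKN, Cor. 1.2] fact.

Not here: the passage from the printed model of [NY22, Thm. 1.1] (group law
`(x,y,z)·(x',y',z') = (x+x', y+y', z+z'+½(xy'−yx'))`, fields `Xf = ∂_x f + ½y∂_z f`,
`Yf = ∂_y f − ½x ∂_z f`) to the left-invariant matrix-model form used here (an explicit
volume-preserving polynomial change of variables), and [NY22, Thm. 1.1] itself.

## References

* [NaorYoung2018] A. Naor, R. Young, Ann. of Math. 188 (2018) 171–279, §3.1 Lemma 3.1, §3.2
  Lemma 3.6 (arXiv:1701.00620 pp. 19, 22–23; arXiv numbering).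
* [NaorYoung2022] A. Naor, R. Young, Acta Math. 229 (2022) 55–200, Thm. 1.1, §1.1.1
  (arXiv:2004.12522 pp. 3–5).
-/

noncomputable section

open Finset
open scoped ContDiff

namespace Literature.Geometry.MetricEmbeddings

/-! ### The discretization -/

section Assembly

open _root_.MeasureTheory _root_.MeasureTheory.Measure
open scoped ENNReal

/-- `Σ_{t<T} 1/(t+1)³ ≤ 2` (compare `Σ 1/n² < 2`: `1/(t+1)³ ≤ 1/t − 1/(t+1)` for `t ≥ 1`). [folklore] -/
theorem sum_range_inv_cube_le_two (T : ℕ) : ∑ t ∈ Finset.range T, 1 / ((t : ℝ) + 1) ^ 3 ≤ 2 := by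
  suffices h : ∀ T : ℕ, 1 ≤ T → ∑ t ∈ Finset.range T, 1 / ((t : ℝ) + 1) ^ 3 ≤ 2 - 1 / (T : ℝ) by
    rcases Nat.eq_zero_or_pos T with rfl | hT
    · simp
    · have h1 := h T hT
      have h2 : (0 : ℝ) ≤ 1 / (T : ℝ) := by positivity
      linarith
  intro T hT
  induction T, hT using Nat.le_induction with
  | base => norm_num [Finset.sum_range_one]
  | succ n hn ih =>
    rw [Finset.sum_range_succ]
    have hn1 : (1 : ℝ) ≤ n := by exact_mod_cast hn
    have hn0 : (n : ℝ) ≠ 0 := by positivity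
    have hn0' : (n : ℝ) + 1 ≠ 0 := by positivity
    have key : 1 / ((n : ℝ) + 1) ^ 3 ≤ 1 / (n : ℝ) - 1 / ((n : ℝ) + 1) := by
      rw [div_sub_div _ _ hn0 hn0', div_le_div_iff₀ (by positivity) (by positivity)]
      ring_nf
      nlinarith
    push_cast
    linarith

/-- The elementary convexity bound `(A + b)⁴ ≤ 8 (A⁴ + b⁴)`
(`8(A⁴+b⁴) − (A+b)⁴ = (A−b)²(7A²+10Ab+7b²)`). [folklore] -/
theorem add_pow_four_le (A b : ℝ) : (A + b) ^ 4 ≤ 8 * (A ^ 4 + b ^ 4) := by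
  have h : 8 * (A ^ 4 + b ^ 4) - (A + b) ^ 4 = (A - b) ^ 2 * (7 * A ^ 2 + 10 * A * b + 7 * b ^ 2) := by
    ring
  have h2 : 0 ≤ 7 * A ^ 2 + 10 * A * b + 7 * b ^ 2 := by nlinarith [sq_nonneg (A + b), sq_nonneg (A - b)]
  nlinarith [sq_nonneg (A - b), h, h2, mul_nonneg (sq_nonneg (A - b)) h2]

set_option maxHeartbeats 400000 in
/-- **Discretization** ([NY18, Lemma 3.6] with `k = 1`, `𝒲(s) = s⁻³`, `p = 1`, `q = 4`, `X = ℝ`,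
combined with the trivial direction of [NY18, Lemma 3.1], for indicators of finite sets):
if every smooth compactly supported `f : ℍ(ℝ) → ℝ` satisfies the (left-invariant, matrix-model)
`L₄` vertical-versus-horizontal inequality
`∫_0^∞ (∫ |f(h cᵗ) − f(h)| dh)⁴ dt/t³ ≤ K⁴ (∫ (|Xf| + |Yf|) dh)⁴`
(`X f(u) = Df(u)[(1,0,0)]`, `Y f(u) = Df(u)[(0,1,u₁)]` the left-invariant horizontal derivatives,
`h cᵗ = (h₁, h₂, h₃ + t)`; the `dt`-integral as a lower Lebesgue integral), then for every finite
`Ω ⊂ ℍ_ℤ³` and every `T`,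
`Σ_{t=1}^{T} |∂ᵗ_v Ω|⁴ / t³ ≤ (C |∂_h Ω|)⁴`
with `C = 4 K C₂ + 2 C₃ + 1` (`C₂ = 30 M |𝓑_{30}|`, `C₃ = 60 |𝓑_{30}|`, `M` a bound for
`|Xχ| + |Yχ|`) — apply the hypothesis to the smearing `F = Σ_{g∈Ω} χ_g` (`integral_fderiv_smear_le`
controls the right side by `C₂ |∂_hΩ|`; `dispCount_center_le_integral` controls `|∂ᵏ_v Ω|` by
`∫|F(hcᵗ) − F(h)|dh + C₃|∂_hΩ|` for `t ∈ [k, k+1]`, which is then integrated in `t`).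
[cite: NaorYoung2018, §3.2 Lemma 3.6 and §3.1 Lemma 3.1] -/
theorem partialSums_of_leftSobolevL4 {K : ℝ} (hK : 0 ≤ K)
    (HL : ∀ f : ℝ × ℝ × ℝ → ℝ, ContDiff ℝ ∞ f → HasCompactSupport f →
      ∫⁻ t in Set.Ioi (0 : ℝ), ENNReal.ofReal ((∫ u, |f (u.1, u.2.1, u.2.2 + t) - f u|) ^ 4 / t ^ 3) ≤
        ENNReal.ofReal ((K * ∫ u, (|fderiv ℝ f u (1, 0, 0)| + |fderiv ℝ f u (0, 1, u.1)|)) ^ 4)) :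
    ∃ C : ℝ, 0 < C ∧ ∀ (Ω : Finset (ℤ × ℤ × ℤ)) (T : ℕ),
      ∑ t ∈ Finset.range T,
        (((Ω.filter fun x => (x.1, x.2.1, x.2.2 + ((t : ℤ) + 1)) ∉ Ω).card : ℝ) +
          ((Ω.filter fun x => (x.1, x.2.1, x.2.2 - ((t : ℤ) + 1)) ∉ Ω).card : ℝ)) ^ 4 /
          ((t : ℝ) + 1) ^ 3 ≤
      (C * ((Ω ×ˢ ({(1, 0, 0), (-1, 0, 0), (0, 1, 0), (0, -1, 0)} : Finset (ℤ × ℤ × ℤ))).filter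
          fun p => heisMul p.1 p.2 ∉ Ω).card) ^ 4 := by
  classical
  obtain ⟨M, hM0, hM⟩ := exists_bound_fderiv_bump3
  set NB : ℝ := ((wordBall_finite 30).toFinset.card : ℝ) with hNB
  set C₂ : ℝ := M * (30 * NB) with hC₂
  set C₃ : ℝ := 2 * (30 * NB) with hC₃
  have hC₂0 : 0 ≤ C₂ := by positivity
  have hC₃0 : 0 ≤ C₃ := by positivity
  refine ⟨4 * K * C₂ + 2 * C₃ + 1, by positivity, fun Ω T => ?_⟩
  set hc : ℝ := (((Ω ×ˢ ({(1, 0, 0), (-1, 0, 0), (0, 1, 0), (0, -1, 0)} :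
    Finset (ℤ × ℤ × ℤ))).filter fun p => heisMul p.1 p.2 ∉ Ω).card : ℝ) with hhc
  have hhc0 : 0 ≤ hc := by positivity
  set F : ℝ × ℝ × ℝ → ℝ := smear Ω with hF
  set A : ℝ → ℝ := fun τ => ∫ u : ℝ × ℝ × ℝ, |F (u.1, u.2.1, u.2.2 + τ) - F u| with hA
  have hA0 : ∀ τ, 0 ≤ A τ := fun τ => integral_nonneg fun u => abs_nonneg _
  set b : ℝ := C₃ * hc with hb
  have hb0 : 0 ≤ b := by positivity
  set v : ℕ → ℝ := fun t => (dispCount Ω (0, 0, (t : ℤ) + 1) : ℝ) with hv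
  have hv0 : ∀ t, 0 ≤ v t := fun t => by positivity
  -- the summands are `v_t⁴ / (t+1)³`
  have hvsum : ∀ t : ℕ,
      (((Ω.filter fun x => (x.1, x.2.1, x.2.2 + ((t : ℤ) + 1)) ∉ Ω).card : ℝ) +
        ((Ω.filter fun x => (x.1, x.2.1, x.2.2 - ((t : ℤ) + 1)) ∉ Ω).card : ℝ)) = v t := by
    intro t
    simp only [hv]
    rw [dispCount_center]
    push_cast
    rfl
  -- (1) the hypothesis for `F`, with the horizontal side controlled by `C₂ hc`
  have hRHS : ∫⁻ τ in Set.Ioi (0 : ℝ), ENNReal.ofReal (A τ ^ 4 / τ ^ 3) ≤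
      ENNReal.ofReal ((K * (C₂ * hc)) ^ 4) := by
    have h := HL F (contDiff_smear Ω) (hasCompactSupport_smear Ω)
    refine h.trans (ENNReal.ofReal_le_ofReal ?_)
    have hG := integral_fderiv_smear_le Ω hM
    have hG0 : 0 ≤ ∫ u : ℝ × ℝ × ℝ,
        (|fderiv ℝ (smear Ω) u (1, 0, 0)| + |fderiv ℝ (smear Ω) u (0, 1, u.1)|) :=
      integral_nonneg fun u => by positivity
    have h1 : K * ∫ u : ℝ × ℝ × ℝ,
        (|fderiv ℝ (smear Ω) u (1, 0, 0)| + |fderiv ℝ (smear Ω) u (0, 1, u.1)|) ≤ K * (C₂ * hc) := by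
      refine mul_le_mul_of_nonneg_left ?_ hK
      simpa [hC₂, hhc, hNB, mul_assoc, mul_comm, mul_left_comm] using hG
    exact pow_le_pow_left₀ (mul_nonneg hK hG0) h1 4
  -- (2) the per-`t` bound, integrated over `τ ∈ (t+1, t+2]`
  have hstep : ∀ t : ℕ, ENNReal.ofReal (v t ^ 4 / ((t : ℝ) + 1) ^ 3) ≤
      64 * (∫⁻ τ in Set.Ioc ((t : ℝ) + 1) ((t : ℝ) + 2), ENNReal.ofReal (A τ ^ 4 / τ ^ 3)) +
        ENNReal.ofReal (8 * b ^ 4 / ((t : ℝ) + 1) ^ 3) := by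
    intro t
    have hIoc : volume (Set.Ioc ((t : ℝ) + 1) ((t : ℝ) + 2)) = 1 := by
      rw [Real.volume_Ioc]
      norm_num
    have hpt : ∀ τ ∈ Set.Ioc ((t : ℝ) + 1) ((t : ℝ) + 2),
        ENNReal.ofReal (v t ^ 4 / ((t : ℝ) + 1) ^ 3) ≤
          ENNReal.ofReal (64 * (A τ ^ 4 / τ ^ 3)) + ENNReal.ofReal (8 * b ^ 4 / ((t : ℝ) + 1) ^ 3) := by
      intro τ hτ
      obtain ⟨h1, h2⟩ := hτ
      have hτ0 : 0 < τ := by linarith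
      -- vertical control at `k = t + 1`
      have hvle : v t ≤ A τ + b := by
        have h := dispCount_center_le_integral Ω (t + 1) (t := τ)
          ⟨by push_cast; linarith, by push_cast; linarith⟩
        have e : ((t + 1 : ℕ) : ℤ) = (t : ℤ) + 1 := by push_cast; ring
        rw [e] at h
        simp only [hv, hA, hb, hC₃, hF, hhc, hNB]
        linarith
      have hreal : v t ^ 4 / ((t : ℝ) + 1) ^ 3 ≤
          64 * (A τ ^ 4 / τ ^ 3) + 8 * b ^ 4 / ((t : ℝ) + 1) ^ 3 := by
        have hpow : v t ^ 4 ≤ 8 * (A τ ^ 4 + b ^ 4) :=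
          (pow_le_pow_left₀ (hv0 t) hvle 4).trans (add_pow_four_le _ _)
        have hτ3 : τ ^ 3 ≤ 8 * ((t : ℝ) + 1) ^ 3 := by
          have : τ ≤ 2 * ((t : ℝ) + 1) := by linarith
          calc τ ^ 3 ≤ (2 * ((t : ℝ) + 1)) ^ 3 := pow_le_pow_left₀ hτ0.le this 3
            _ = 8 * ((t : ℝ) + 1) ^ 3 := by ring
        have ht1 : (0 : ℝ) < ((t : ℝ) + 1) ^ 3 := by positivity
        have hτ3pos : (0 : ℝ) < τ ^ 3 := by positivity
        have hA4 : 0 ≤ A τ ^ 4 := by positivity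
        calc v t ^ 4 / ((t : ℝ) + 1) ^ 3 ≤ 8 * (A τ ^ 4 + b ^ 4) / ((t : ℝ) + 1) ^ 3 :=
              div_le_div_of_nonneg_right hpow ht1.le
          _ = 8 * A τ ^ 4 * (1 / ((t : ℝ) + 1) ^ 3) + 8 * b ^ 4 / ((t : ℝ) + 1) ^ 3 := by ring
          _ ≤ 8 * A τ ^ 4 * (8 / τ ^ 3) + 8 * b ^ 4 / ((t : ℝ) + 1) ^ 3 := by
              have h : 1 / ((t : ℝ) + 1) ^ 3 ≤ 8 / τ ^ 3 := by
                rw [div_le_div_iff₀ ht1 hτ3pos]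
                linarith
              exact add_le_add (mul_le_mul_of_nonneg_left h (by positivity : (0 : ℝ) ≤ 8 * A τ ^ 4)) le_rfl
          _ = 64 * (A τ ^ 4 / τ ^ 3) + 8 * b ^ 4 / ((t : ℝ) + 1) ^ 3 := by ring
      calc ENNReal.ofReal (v t ^ 4 / ((t : ℝ) + 1) ^ 3)
          ≤ ENNReal.ofReal (64 * (A τ ^ 4 / τ ^ 3) + 8 * b ^ 4 / ((t : ℝ) + 1) ^ 3) :=
            ENNReal.ofReal_le_ofReal hreal
        _ = _ := ENNReal.ofReal_add (by positivity) (by positivity)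
    calc ENNReal.ofReal (v t ^ 4 / ((t : ℝ) + 1) ^ 3)
        = ∫⁻ _ in Set.Ioc ((t : ℝ) + 1) ((t : ℝ) + 2), ENNReal.ofReal (v t ^ 4 / ((t : ℝ) + 1) ^ 3) := by
          rw [setLIntegral_const, hIoc, mul_one]
      _ ≤ ∫⁻ τ in Set.Ioc ((t : ℝ) + 1) ((t : ℝ) + 2),
            (ENNReal.ofReal (64 * (A τ ^ 4 / τ ^ 3)) + ENNReal.ofReal (8 * b ^ 4 / ((t : ℝ) + 1) ^ 3)) :=
          setLIntegral_mono' measurableSet_Ioc hpt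
      _ = (∫⁻ τ in Set.Ioc ((t : ℝ) + 1) ((t : ℝ) + 2), ENNReal.ofReal (64 * (A τ ^ 4 / τ ^ 3))) +
            ENNReal.ofReal (8 * b ^ 4 / ((t : ℝ) + 1) ^ 3) := by
          rw [lintegral_add_right _ measurable_const, setLIntegral_const, hIoc, mul_one]
      _ = 64 * (∫⁻ τ in Set.Ioc ((t : ℝ) + 1) ((t : ℝ) + 2), ENNReal.ofReal (A τ ^ 4 / τ ^ 3)) +
            ENNReal.ofReal (8 * b ^ 4 / ((t : ℝ) + 1) ^ 3) := by
          congr 1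
          rw [← lintegral_const_mul' _ _ (by norm_num)]
          refine lintegral_congr fun τ => ?_
          rw [ENNReal.ofReal_mul (by norm_num), ENNReal.ofReal_ofNat]
  -- (3) sum over `t < T`
  have hdisj : Set.PairwiseDisjoint (↑(Finset.range T))
      (fun t : ℕ => Set.Ioc ((t : ℝ) + 1) ((t : ℝ) + 2)) := by
    intro t _ t' _ hne
    rw [Function.onFun, Set.Ioc_disjoint_Ioc]
    rcases lt_or_gt_of_ne hne with h | h
    · have : (t : ℝ) + 1 ≤ t' := by exact_mod_cast h
      rw [min_le_iff, le_max_iff, le_max_iff]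
      left; right; linarith
    · have : (t' : ℝ) + 1 ≤ t := by exact_mod_cast h
      rw [min_le_iff, le_max_iff, le_max_iff]
      right; left; linarith
  have hunion : ∑ t ∈ Finset.range T,
      (∫⁻ τ in Set.Ioc ((t : ℝ) + 1) ((t : ℝ) + 2), ENNReal.ofReal (A τ ^ 4 / τ ^ 3)) ≤
        ENNReal.ofReal ((K * (C₂ * hc)) ^ 4) := by
    rw [← lintegral_biUnion_finset hdisj (fun t _ => measurableSet_Ioc)]
    refine (lintegral_mono_set ?_).trans hRHS
    intro τ hτ
    simp only [Set.mem_iUnion, Set.mem_Ioc, exists_prop] at hτ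
    obtain ⟨t, _, h1, _⟩ := hτ
    rw [Set.mem_Ioi]
    have : (0 : ℝ) ≤ t := by positivity
    linarith
  have hconst : ∑ t ∈ Finset.range T, ENNReal.ofReal (8 * b ^ 4 / ((t : ℝ) + 1) ^ 3) ≤
      ENNReal.ofReal (16 * b ^ 4) := by
    rw [← ENNReal.ofReal_sum_of_nonneg (fun t _ => by positivity)]
    refine ENNReal.ofReal_le_ofReal ?_
    have h := sum_range_inv_cube_le_two T
    calc ∑ t ∈ Finset.range T, 8 * b ^ 4 / ((t : ℝ) + 1) ^ 3
        = 8 * b ^ 4 * ∑ t ∈ Finset.range T, 1 / ((t : ℝ) + 1) ^ 3 := by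
          rw [Finset.mul_sum]
          exact Finset.sum_congr rfl fun t _ => by ring
      _ ≤ 8 * b ^ 4 * 2 := mul_le_mul_of_nonneg_left h (by positivity)
      _ = 16 * b ^ 4 := by ring
  have hE : ENNReal.ofReal (∑ t ∈ Finset.range T, v t ^ 4 / ((t : ℝ) + 1) ^ 3) ≤
      ENNReal.ofReal (64 * (K * (C₂ * hc)) ^ 4 + 16 * b ^ 4) := by
    rw [ENNReal.ofReal_sum_of_nonneg (fun t _ => by positivity)]
    calc ∑ t ∈ Finset.range T, ENNReal.ofReal (v t ^ 4 / ((t : ℝ) + 1) ^ 3)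
        ≤ ∑ t ∈ Finset.range T,
            (64 * (∫⁻ τ in Set.Ioc ((t : ℝ) + 1) ((t : ℝ) + 2), ENNReal.ofReal (A τ ^ 4 / τ ^ 3)) +
              ENNReal.ofReal (8 * b ^ 4 / ((t : ℝ) + 1) ^ 3)) := Finset.sum_le_sum fun t _ => hstep t
      _ = 64 * ∑ t ∈ Finset.range T,
            (∫⁻ τ in Set.Ioc ((t : ℝ) + 1) ((t : ℝ) + 2), ENNReal.ofReal (A τ ^ 4 / τ ^ 3)) +
            ∑ t ∈ Finset.range T, ENNReal.ofReal (8 * b ^ 4 / ((t : ℝ) + 1) ^ 3) := by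
          rw [Finset.sum_add_distrib, Finset.mul_sum]
      _ ≤ 64 * ENNReal.ofReal ((K * (C₂ * hc)) ^ 4) + ENNReal.ofReal (16 * b ^ 4) :=
          add_le_add (by gcongr) hconst
      _ = ENNReal.ofReal (64 * (K * (C₂ * hc)) ^ 4 + 16 * b ^ 4) := by
          rw [ENNReal.ofReal_add (by positivity) (by positivity)]
          congr 1
          rw [ENNReal.ofReal_mul (by norm_num), ENNReal.ofReal_ofNat]
  have hreal : ∑ t ∈ Finset.range T, v t ^ 4 / ((t : ℝ) + 1) ^ 3 ≤
      64 * (K * (C₂ * hc)) ^ 4 + 16 * b ^ 4 :=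
    (ENNReal.ofReal_le_ofReal_iff (by positivity)).mp hE
  -- (4) conclude
  have hfinal : 64 * (K * (C₂ * hc)) ^ 4 + 16 * b ^ 4 ≤ ((4 * K * C₂ + 2 * C₃ + 1) * hc) ^ 4 := by
    rw [hb]
    have hx : 0 ≤ K * C₂ * hc := by positivity
    have hy : 0 ≤ C₃ * hc := by positivity
    nlinarith [pow_le_pow_left₀ (by positivity : (0 : ℝ) ≤ 4 * K * C₂ * hc + 2 * C₃ * hc)
      (by nlinarith : 4 * K * C₂ * hc + 2 * C₃ * hc ≤ (4 * K * C₂ + 2 * C₃ + 1) * hc) 4,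
      mul_nonneg hx hy, mul_nonneg (mul_nonneg hx hy) (mul_nonneg hx hy),
      pow_nonneg hx 4, pow_nonneg hy 4, mul_nonneg (pow_nonneg hx 2) (pow_nonneg hy 2),
      mul_nonneg (pow_nonneg hx 3) hy, mul_nonneg hx (pow_nonneg hy 3)]
  calc ∑ t ∈ Finset.range T,
        (((Ω.filter fun x => (x.1, x.2.1, x.2.2 + ((t : ℤ) + 1)) ∉ Ω).card : ℝ) +
          ((Ω.filter fun x => (x.1, x.2.1, x.2.2 - ((t : ℤ) + 1)) ∉ Ω).card : ℝ)) ^ 4 /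
          ((t : ℝ) + 1) ^ 3
      = ∑ t ∈ Finset.range T, v t ^ 4 / ((t : ℝ) + 1) ^ 3 :=
        Finset.sum_congr rfl fun t _ => by rw [hvsum t]
    _ ≤ 64 * (K * (C₂ * hc)) ^ 4 + 16 * b ^ 4 := hreal
    _ ≤ ((4 * K * C₂ + 2 * C₃ + 1) * hc) ^ 4 := hfinal

end Assembly


/-- **The Cheeger–Kleiner–Naor bound from the continuous `L₄` vertical-versus-horizontal inequality
(left-invariant matrix-model form).** If every smooth compactly supported `f : ℍ(ℝ) → ℝ` satisfies
`∫_0^∞ (∫ |f(h cᵗ) − f(h)| dh)⁴ dt/t³ ≤ K⁴ (∫ (|Xf| + |Yf|) dh)⁴` — the inequality of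
[NY22, Thm. 1.1] up to the model of `ℍ(ℝ)` — then `CheegerKleinerNaor2011_wordBall_l1Distortion`
([CKN, Cor. 1.2] as vendored) holds: `partialSums_of_leftSobolevL4` (this file, [NY18, Lemma 3.6])
and `CheegerKleinerNaor2011_wordBall_l1Distortion.of_partialSums` ([NY18, §1.3]).
[cite: NaorYoung2018, §3.2 Lemma 3.6 and §1.3] [cite: NaorYoung2022, Thm. 1.1 and §1.1.1] -/
theorem CheegerKleinerNaor2011_wordBall_l1Distortion.of_leftSobolevL4 {K : ℝ} (hK : 0 ≤ K)
    (HL : ∀ f : ℝ × ℝ × ℝ → ℝ, ContDiff ℝ ∞ f → HasCompactSupport f →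
      ∫⁻ t in Set.Ioi (0 : ℝ), ENNReal.ofReal ((∫ u, |f (u.1, u.2.1, u.2.2 + t) - f u|) ^ 4 / t ^ 3) ≤
        ENNReal.ofReal ((K * ∫ u, (|fderiv ℝ f u (1, 0, 0)| + |fderiv ℝ f u (0, 1, u.1)|)) ^ 4)) :
    CheegerKleinerNaor2011_wordBall_l1Distortion :=
  CheegerKleinerNaor2011_wordBall_l1Distortion.of_partialSums (partialSums_of_leftSobolevL4 hK HL)

end Literature.Geometry.MetricEmbeddings

end
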